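import Literature.NumberTheory.Automorphic.Liu2021.ThetaLiftFromLineCentralCharacter
import Literature.NumberTheory.Automorphic.UnitaryGroupAdelicLineTorus
import Summits.HodgeConjecture.HodgeConjecture.Theorems.H413SpectrumJunction
import HarnessLib

-- As in the lineage (`ThetaLiftFromLineCharacters`, `ThetaLiftFromLineCentralCharacter`): statements over the theta-kernel datum
-- elaborate to very large types; elaborate sequentially.
set_option Elab.async false

/-!
# Crux `HLiu418`, line LD1 (`stub_S1_facts` in-house), organ (P) — piece (P♭-θ): THE CENTRE OF `U(H)` ON THE CHARACTER-THETA CLASSES OF AN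
# ABSTRACT FRAME TRANSPORT, and «two character seams of one line inside representations with the same central character have the same character»

Cell `hodgecm-mathlib`, FLOOR 0, line LD1 (socket 27458 `Cruxes/HLiu418/Lines/F0_AlbCm.lean`, stub `stub_S1_facts` = books #73 E1θhol [Liu2021,
Prop. D.4 (1)]); skeleton `F0/P6/LD/LD1-plan/g0/StubS1facts.inhouse.skeleton.v5.lean` (22e0f4f496aabf7d), organ (P) `stub_thetaCharPinned : ThetaCharPinned₂`
(= the CHARACTER half (P♭) of road memo `F0/P6/LD/LD1-p02/g0/ROAD-organP-ThetaDatumPinned.v1.LD1-p02g0.md`); seat LD1-p02 (g0); `--supports stmt-HodgeConjecture-24832`.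
THEOREMS ONLY — no definition, no instance, no notation, no `sorry`.

WHY A NEW FILE (not ★ `ThetaLiftFromLineCentralCharacter` §3–§4 verbatim).  Those are typed for the LITERAL transport `cmAdelicFrameTransport L N H dV g hg`
under the UNSCALED frame `ᵗ(c̄g) H g = diag dV`; the LD1∕LD2 organs carry an ABSTRACT `ιA : U(H)(𝔸) →* U(diag dV)(𝔸)` pinned only by its matrix formula
`↑(ιA k) = g_𝔸⁻¹ k g_𝔸` under the letter's SCALED frame `formCongr c g (t•H) = diag dV`.  Here `ιA` is asked exactly two things: the matrix formula (so ★
`frameTransport_adelicCenter` gives `ιA(u·1_H) = u·1_{diag dV}`) and «rational points go to rational points» (`hιArat`, the left-invariance input).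
CONTENTS (generic rank `N`): §1 `lineThetaLiftFun_transport_leftInvariant`; §2 `lineThetaLiftFun_pairRep_one_charCM_apply` (`Θ̃_{ω(1,h)Ψ}(ξ)(p) = ξ(h̄)·Θ̃_Ψ(ξ)(p)`
at EVERY `p`, ★ `thetaLift_act_right_charCM`) and **`lineThetaLiftFun_mul_adelicCenter`** (`Θ̃_Ψ(ξ)(p · u·1_{diag dV}) = ξ([u·1_W])·Θ̃_Ψ(ξ)(p)`: ★
`thetaLiftFun_mul_right` + ★ `pairRep_adelicCenter_fst_eq_snd` «`ω(u·1_V,1) = ω(1,u·1_W)`»); §3 **`rightRegular_adelicCenter_toLp_transport_charCM`**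
(`R(u·1_H)[Θ̃_Ψ(ξ)∘ιA] = ξ([u·1_W])•[Θ̃_Ψ(ξ)∘ιA]` for ANY `MemLp` witness, ★ `toLp_toQuotFun_mul_right`) and **`centralCharacter_apply_eq_charCM_of_mem`** (the
class in `P`, non-zero, centre through `χP` ⇒ `χP(u) = ξ([u·1_W])`); §4 `exists_adelicCenter_JW_eq` (on the LINE the centre is everything, ★ `coe_eq_det_smul_one`),
`charQuot_ext_of_adelicCenter`; §5 **`charCM_eq_of_seams_of_centralCharacter_eq`** — non-zero `ξ′`-∕`ξ″`-theta classes from the SAME line along the same `ιA`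
in `P`, `P′` with the SAME central character ⇒ `ξ′ = ξ″`.  With ★-candidate `F0P6LD1CentralCharacterPin.centralCharacter_eq_of_hasFinComponent` this is organ (P)
`ThetaCharPinned₂` of LD1 skeleton v5 (the character pin on a common line); the LINE pin (organ (L)) is not touched here.

HONEST LABEL: HC_CM is proved only modulo the 7 printed citations (2 remaining: hLiu418 = stmt-HodgeConjecture-24832, h413 = stmt-HodgeConjecture-24833)
until rung 0 closes; this file discharges none of them (in-house helper toward organ (P) of line LD1).

## References
* [Liu2021] Y. Liu, Camb. J. Math. 9 (2021) = arXiv:2102.11518: proof of Prop. 4.13 Case 1 (l. 2136–2137, p. 48: «the central character `χ` of `π`»);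
  App. D §D.1 Step 3, proof of Prop. D.4 (1) (p. 131).
* [GelbartRogawski1991] S. Gelbart, J. Rogawski, Invent. Math. 105 (1991), §3.1 Prop. 3.1.1 p. 455 and Remark p. 457 (`(u·1_V) ⊗ 1 = 1 ⊗ (u·1_W)`).
* [BorelJacquet1979] A. Borel, H. Jacquet, PSPM 33.1 (1979), §4.2, §4.6.
* [FleigEtAl2018] P. Fleig, H. Gustafsson, A. Kleinschmidt, D. Persson, CUP (2018), §12.3 Def. 12.5 (12.37) p. 296 (theta lift).
* [Mok2014] C. P. Mok, Mem. AMS 235 (2015), §1 Notation p. 5 (centre of `U_{E/F}(N)`).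
-/

set_option autoImplicit false
-- the mandated namespace has the single-problem summit's repeated segment (`HodgeConjecture.HodgeConjecture`)
set_option linter.dupNamespace false

noncomputable section

open NumberField MeasureTheory IsDedekindDomain
open scoped Matrix ComplexOrder ENNReal
open Literature.NumberTheory.Automorphic Literature.NumberTheory.Automorphic.UnitaryGroup
open Literature.NumberTheory.Automorphic.UnitaryGroup.CotangentForms
open Literature.NumberTheory.Automorphic.IdeleClassGroup
open Literature.NumberTheory.Automorphic.Liu2021
open Literature.NumberTheory.Automorphic.Liu2021.Def411WeilCarriers
open Literature.NumberTheory.Automorphic.Liu2021.Def411WeilCarriersDoubling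
open Literature.NumberTheory.GelbartRogawski1991 Literature.NumberTheory.GelbartRogawski1991.UnitaryDualPair
open Literature.NumberTheory.Weil1964
open Literature.RepresentationTheory.Liu2021
open Literature.RepresentationTheory.CompactGroups
open Summit.HodgeConjecture.HodgeConjecture.Cruxes.H413.SpectrumJunction

namespace Summit.HodgeConjecture.HodgeConjecture.Cruxes.HLiu418.F0P6LD1ThetaCharacterPin

section Transport

variable (L : Type) [Field L] [NumberField L] [IsCMField L] (N : ℕ) (H : Matrix (Fin N) (Fin N) L)
  {n' : ℕ} (e₁ : Fin N × Fin 1 ≃ Fin n') (dV : Fin N → L) (hdV : ∀ i, IsCMField.complexConj L (dV i) = dV i)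
  (hdV0 : ∀ i, dV i ≠ 0) (g : GL (Fin N) L)
  (μ : Literature.NumberTheory.Automorphic.IdeleClassGroup L →ₜ* Circle) (hμ : IsConjugateSymplectic L μ) (a : (↥(maximalRealSubfield L))ˣ)
  (hρ : HasThetaMajorants fun
      (p : ↥(UnitaryGroup.adelic (↥(maximalRealSubfield L)) L (IsCMField.complexConj L) N (Matrix.diagonal dV)) ×
        ↥(UnitaryGroup.adelic (↥(maximalRealSubfield L)) L (IsCMField.complexConj L) 1 (JW (↥(maximalRealSubfield L)) L a)))
      (Φ : piSchwartzBruhat (↥(maximalRealSubfield L)) (Fin n')) =>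
        (pairRep (↥(maximalRealSubfield L)) L (IsCMField.complexConj L) N 1 e₁ (Matrix.diagonal dV) (JW (↥(maximalRealSubfield L)) L a)
          (chiSplittingLine L e₁ dV hdV hdV0 (toHeckeCharacter L μ) (isUnitary_toHeckeCharacter L μ)
            ((isOscillatorChar_toHeckeCharacter_iff μ).mpr hμ) (TW (↥(maximalRealSubfield L)) a)
            (isUnit_det_TW (↥(maximalRealSubfield L)) a) (JW (↥(maximalRealSubfield L)) L a) (JW_eq (↥(maximalRealSubfield L)) L a))) p Φ)
  (ιA : (adelicGroupData (↥(maximalRealSubfield L)) L (IsCMField.complexConj L) N H).Adelic →*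
    ↥(UnitaryGroup.adelic (↥(maximalRealSubfield L)) L (IsCMField.complexConj L) N (Matrix.diagonal dV)))
  (hιA : ∀ k, ((ιA k : ↥(UnitaryGroup.adelic (↥(maximalRealSubfield L)) L (IsCMField.complexConj L) N (Matrix.diagonal dV))) :
      GL (Fin N) (AdeleRing (𝓞 L) L)) =
    (toAdeleGL L g)⁻¹ * adelicVal (↥(maximalRealSubfield L)) L (IsCMField.complexConj L) N H k * toAdeleGL L g)
  (hιArat : ∀ γ : (adelicGroupData (↥(maximalRealSubfield L)) L (IsCMField.complexConj L) N H).Rational,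
    ιA ((adelicGroupData (↥(maximalRealSubfield L)) L (IsCMField.complexConj L) N H).toAdelic γ) ∈
      (UnitaryGroup.toAdelic (↥(maximalRealSubfield L)) L (IsCMField.complexConj L) N (Matrix.diagonal dV)).range)

variable
  [CompactSpace (↥(UnitaryGroup.adelic (↥(maximalRealSubfield L)) L (IsCMField.complexConj L) N (Matrix.diagonal dV)) ⧸
    (UnitaryGroup.toAdelic (↥(maximalRealSubfield L)) L (IsCMField.complexConj L) N (Matrix.diagonal dV)).range)]
  [MeasurableSpace (↥(UnitaryGroup.adelic (↥(maximalRealSubfield L)) L (IsCMField.complexConj L) 1 (JW (↥(maximalRealSubfield L)) L a)) ⧸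
    (UnitaryGroup.toAdelic (↥(maximalRealSubfield L)) L (IsCMField.complexConj L) 1 (JW (↥(maximalRealSubfield L)) L a)).range)]
  (μW : Measure (↥(UnitaryGroup.adelic (↥(maximalRealSubfield L)) L (IsCMField.complexConj L) 1 (JW (↥(maximalRealSubfield L)) L a)) ⧸
    (UnitaryGroup.toAdelic (↥(maximalRealSubfield L)) L (IsCMField.complexConj L) 1 (JW (↥(maximalRealSubfield L)) L a)).range))
  (Ψ : piSchwartzBruhat (↥(maximalRealSubfield L)) (Fin n'))

include hιA hιArat

/-! ## §1 Left invariance of the transported lift -/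

set_option maxHeartbeats 1600000 in
omit hιA in
/-- **Left invariance** of `x ↦ Θ̃_Ψ(f)(ιA x)` under `A_G · U(H)(L⁺) = U(H)(L⁺)`: the transport carries rational points to rational points (`hιArat`) and
the lift is left-`U(diag dV)(L⁺)`-invariant (★ `thetaLiftFun_mul_left`). [cite: BorelJacquet1979, §4.2] -/
theorem lineThetaLiftFun_transport_leftInvariant
    (f : C(↥(UnitaryGroup.adelic (↥(maximalRealSubfield L)) L (IsCMField.complexConj L) 1 (JW (↥(maximalRealSubfield L)) L a)) ⧸
      (UnitaryGroup.toAdelic (↥(maximalRealSubfield L)) L (IsCMField.complexConj L) 1 (JW (↥(maximalRealSubfield L)) L a)).range, ℂ)) :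
    ∀ γ ∈ (adelicGroupData (↥(maximalRealSubfield L)) L (IsCMField.complexConj L) N H).quotientSubgroup, ∀ x,
      (fun y => (lineThetaKernelDatum L N e₁ dV hdV hdV0 μ hμ a hρ).thetaLiftFun μW Ψ f (ιA y)) (γ * x) =
        (fun y => (lineThetaKernelDatum L N e₁ dV hdV hdV0 μ hμ a hρ).thetaLiftFun μW Ψ f (ιA y)) x := by
  intro γ hγ x
  rw [quotientSubgroup_adelicGroupData] at hγ
  obtain ⟨γ₀, rfl⟩ := hγ
  haveI : CompactSpace (↥(UnitaryGroup.adelic (↥(maximalRealSubfield L)) L (IsCMField.complexConj L) 1 (JW (↥(maximalRealSubfield L)) L a)) ⧸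
      (UnitaryGroup.toAdelic (↥(maximalRealSubfield L)) L (IsCMField.complexConj L) 1 (JW (↥(maximalRealSubfield L)) L a)).range) :=
    compactSpace_quotient_range_toAdelic_JW L a
  show (lineThetaKernelDatum L N e₁ dV hdV hdV0 μ hμ a hρ).thetaLiftFun μW Ψ f (ιA (_ * x)) = _
  rw [map_mul]
  exact (lineThetaKernelDatum L N e₁ dV hdV hdV0 μ hμ a hρ).thetaLiftFun_mul_left μW Ψ f (hιArat γ₀) (ιA x)


variable
  [BorelSpace (↥(UnitaryGroup.adelic (↥(maximalRealSubfield L)) L (IsCMField.complexConj L) 1 (JW (↥(maximalRealSubfield L)) L a)) ⧸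
    (UnitaryGroup.toAdelic (↥(maximalRealSubfield L)) L (IsCMField.complexConj L) 1 (JW (↥(maximalRealSubfield L)) L a)).range)]
  [IsFiniteMeasure μW]
  [SMulInvariantMeasure
    ↥(UnitaryGroup.adelic (↥(maximalRealSubfield L)) L (IsCMField.complexConj L) 1 (JW (↥(maximalRealSubfield L)) L a))
    (↥(UnitaryGroup.adelic (↥(maximalRealSubfield L)) L (IsCMField.complexConj L) 1 (JW (↥(maximalRealSubfield L)) L a)) ⧸
      (UnitaryGroup.toAdelic (↥(maximalRealSubfield L)) L (IsCMField.complexConj L) 1 (JW (↥(maximalRealSubfield L)) L a)).range) μW]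

/-! ## §2 `ξ`-covariance in the Schwartz variable, at every point of `U(diag dV)(𝔸)`, and the centre of `U(diag dV)` -/

set_option maxHeartbeats 1600000 in
omit hιA hιArat in
/-- **`Θ̃_{ω(1,h)Ψ}(ξ)(p) = ξ(h̄) · Θ̃_Ψ(ξ)(p)`** for every `p ∈ U(diag dV)(𝔸_{L⁺})`, `h ∈ U(⟨a⟩)(𝔸_{L⁺})` and every continuous unitary character `ξ` of
`[U(⟨a⟩)]` (★ `ThetaKernelDatum.thetaLift_act_right_charCM`; ★ `lineThetaLiftFun_pairRep_one_charCM` is the case `p = cmAdelicFrameTransport … x`).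
[cite: FleigEtAl2018, §12.3 Def. 12.5 (12.37) p. 296] [cite: GelbartRogawski1991, §3.2 p. 457] -/
theorem lineThetaLiftFun_pairRep_one_charCM_apply
    (h : ↥(UnitaryGroup.adelic (↥(maximalRealSubfield L)) L (IsCMField.complexConj L) 1 (JW (↥(maximalRealSubfield L)) L a))) :
    haveI := normal_range_toAdelic_JW L a
    ∀ (ξ : PontryaginDual (↥(UnitaryGroup.adelic (↥(maximalRealSubfield L)) L (IsCMField.complexConj L) 1 (JW (↥(maximalRealSubfield L)) L a)) ⧸
        (UnitaryGroup.toAdelic (↥(maximalRealSubfield L)) L (IsCMField.complexConj L) 1 (JW (↥(maximalRealSubfield L)) L a)).range))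
      (p : ↥(UnitaryGroup.adelic (↥(maximalRealSubfield L)) L (IsCMField.complexConj L) N (Matrix.diagonal dV))),
      (lineThetaKernelDatum L N e₁ dV hdV hdV0 μ hμ a hρ).thetaLiftFun μW
          ((pairRep (↥(maximalRealSubfield L)) L (IsCMField.complexConj L) N 1 e₁ (Matrix.diagonal dV) (JW (↥(maximalRealSubfield L)) L a)
            (chiSplittingLine L e₁ dV hdV hdV0 (toHeckeCharacter L μ) (isUnitary_toHeckeCharacter L μ)
              ((isOscillatorChar_toHeckeCharacter_iff μ).mpr hμ) (TW (↥(maximalRealSubfield L)) a)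
              (isUnit_det_TW (↥(maximalRealSubfield L)) a) (JW (↥(maximalRealSubfield L)) L a) (JW_eq (↥(maximalRealSubfield L)) L a)))
            (1, h) Ψ) (charCM ξ) p =
        ((ξ (QuotientGroup.mk h) : Circle) : ℂ) * (lineThetaKernelDatum L N e₁ dV hdV hdV0 μ hμ a hρ).thetaLiftFun μW Ψ (charCM ξ) p := by
  haveI := normal_range_toAdelic_JW L a
  intro ξ p
  haveI : CompactSpace (↥(UnitaryGroup.adelic (↥(maximalRealSubfield L)) L (IsCMField.complexConj L) 1 (JW (↥(maximalRealSubfield L)) L a)) ⧸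
      (UnitaryGroup.toAdelic (↥(maximalRealSubfield L)) L (IsCMField.complexConj L) 1 (JW (↥(maximalRealSubfield L)) L a)).range) :=
    compactSpace_quotient_range_toAdelic_JW L a
  rw [ThetaKernelDatum.thetaLiftFun_apply, ThetaKernelDatum.thetaLiftFun_apply]
  have key := (lineThetaKernelDatum L N e₁ dV hdV hdV0 μ hμ a hρ).thetaLift_act_right_charCM μW Ψ h ξ
  rw [lineThetaKernelDatum_act_s] at key
  rw [key, ContinuousMap.smul_apply, smul_eq_mul]

set_option maxHeartbeats 1600000 in
omit hιA hιArat in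
/-- **`Θ̃_Ψ(ξ)(p · u·1_{diag dV}) = ξ([u·1_W]) · Θ̃_Ψ(ξ)(p)`** for every `p ∈ U(diag dV)(𝔸_{L⁺})` and `u ∈ U(1)(𝔸_{L⁺})`: right translation is the Weil
action (★ `thetaLiftFun_mul_right`), `ω(u·1_V, 1) = ω(1, u·1_W)` (★ `pairRep_adelicCenter_fst_eq_snd`) and the `ξ`-covariance above.  (Along a frame
transport `ιA` with `ιA(u·1_H) = u·1_{diag dV}` — ★ `frameTransport_adelicCenter` — this is the centre of `U(H)` on `Θ̃_Ψ(ξ) ∘ ιA`.)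
[cite: GelbartRogawski1991, §3.1 Prop. 3.1.1 p. 455; Remark p. 457] [cite: Liu2021, proof of Prop. 4.13 Case 1 l. 2136–2137] -/
theorem lineThetaLiftFun_mul_adelicCenter (u : ↥(adelicOne (↥(maximalRealSubfield L)) L (IsCMField.complexConj L))) :
    haveI := normal_range_toAdelic_JW L a
    ∀ (ξ : PontryaginDual (↥(UnitaryGroup.adelic (↥(maximalRealSubfield L)) L (IsCMField.complexConj L) 1 (JW (↥(maximalRealSubfield L)) L a)) ⧸
        (UnitaryGroup.toAdelic (↥(maximalRealSubfield L)) L (IsCMField.complexConj L) 1 (JW (↥(maximalRealSubfield L)) L a)).range))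
      (p : ↥(UnitaryGroup.adelic (↥(maximalRealSubfield L)) L (IsCMField.complexConj L) N (Matrix.diagonal dV))),
      (lineThetaKernelDatum L N e₁ dV hdV hdV0 μ hμ a hρ).thetaLiftFun μW Ψ (charCM ξ)
          (p * adelicCenter (↥(maximalRealSubfield L)) L (IsCMField.complexConj L) N (Matrix.diagonal dV) u) =
        ((ξ (QuotientGroup.mk (adelicCenter (↥(maximalRealSubfield L)) L (IsCMField.complexConj L) 1 (JW (↥(maximalRealSubfield L)) L a) u)) :
            Circle) : ℂ) *
          (lineThetaKernelDatum L N e₁ dV hdV hdV0 μ hμ a hρ).thetaLiftFun μW Ψ (charCM ξ) p := by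
  haveI := normal_range_toAdelic_JW L a
  intro ξ p
  haveI : CompactSpace (↥(UnitaryGroup.adelic (↥(maximalRealSubfield L)) L (IsCMField.complexConj L) 1 (JW (↥(maximalRealSubfield L)) L a)) ⧸
      (UnitaryGroup.toAdelic (↥(maximalRealSubfield L)) L (IsCMField.complexConj L) 1 (JW (↥(maximalRealSubfield L)) L a)).range) :=
    compactSpace_quotient_range_toAdelic_JW L a
  rw [(lineThetaKernelDatum L N e₁ dV hdV hdV0 μ hμ a hρ).thetaLiftFun_mul_right μW Ψ (charCM ξ) _ _,
    lineThetaKernelDatum_act_s, pairRep_adelicCenter_fst_eq_snd]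
  exact lineThetaLiftFun_pairRep_one_charCM_apply L N e₁ dV hdV hdV0 μ hμ a hρ μW Ψ _ ξ p

/-! ## §3 On `L²`-classes: the centre acts on `[Θ̃_Ψ(ξ) ∘ ιA]` through `ξ`, and reads the central character of any `P` containing it -/

set_option maxHeartbeats 1600000 in
/-- **`R(u·1_H) [Θ̃_Ψ(ξ) ∘ ιA] = ξ([u·1_W]) • [Θ̃_Ψ(ξ) ∘ ιA]`** in `L²([U(H)], ν)`, for EVERY square-integrability witness `hθ` of the descended function
(the seam's own witness) and every measure `ν` invariant under the right regular action — §2 on classes (★ `toLp_toQuotFun_mul_right`).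
[cite: BorelJacquet1979, §4.6] [cite: GelbartRogawski1991, §3.1 Remark p. 457] [cite: Liu2021, proof of Prop. 4.13 Case 1 l. 2136–2137] -/
theorem rightRegular_adelicCenter_toLp_transport_charCM
    (ν : Measure (adelicGroupData (↥(maximalRealSubfield L)) L (IsCMField.complexConj L) N H).automorphicQuotient)
    [SMulInvariantMeasure (adelicGroupData (↥(maximalRealSubfield L)) L (IsCMField.complexConj L) N H).Adelic
      (adelicGroupData (↥(maximalRealSubfield L)) L (IsCMField.complexConj L) N H).automorphicQuotient ν]
    (u : ↥(adelicOne (↥(maximalRealSubfield L)) L (IsCMField.complexConj L))) :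
    haveI := normal_range_toAdelic_JW L a
    ∀ (ξ : PontryaginDual (↥(UnitaryGroup.adelic (↥(maximalRealSubfield L)) L (IsCMField.complexConj L) 1 (JW (↥(maximalRealSubfield L)) L a)) ⧸
        (UnitaryGroup.toAdelic (↥(maximalRealSubfield L)) L (IsCMField.complexConj L) 1 (JW (↥(maximalRealSubfield L)) L a)).range))
      (hθ : MemLp (toQuotFun (adelicGroupData (↥(maximalRealSubfield L)) L (IsCMField.complexConj L) N H) fun x =>
        (lineThetaKernelDatum L N e₁ dV hdV hdV0 μ hμ a hρ).thetaLiftFun μW Ψ (charCM ξ) (ιA x)) 2 ν),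
      (adelicGroupData (↥(maximalRealSubfield L)) L (IsCMField.complexConj L) N H).rightRegular ν
          (adelicCenter (↥(maximalRealSubfield L)) L (IsCMField.complexConj L) N H u) (MemLp.toLp _ hθ) =
        ((ξ (QuotientGroup.mk (adelicCenter (↥(maximalRealSubfield L)) L (IsCMField.complexConj L) 1 (JW (↥(maximalRealSubfield L)) L a) u)) :
            Circle) : ℂ) • MemLp.toLp _ hθ := by
  haveI := normal_range_toAdelic_JW L a
  intro ξ hθ
  obtain ⟨z, hz⟩ : ∃ z : (adelicGroupData (↥(maximalRealSubfield L)) L (IsCMField.complexConj L) N H).Adelic,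
      z = adelicCenter (↥(maximalRealSubfield L)) L (IsCMField.complexConj L) N H u := ⟨_, rfl⟩
  set cξ : ℂ := ((ξ (QuotientGroup.mk (adelicCenter (↥(maximalRealSubfield L)) L (IsCMField.complexConj L) 1
    (JW (↥(maximalRealSubfield L)) L a) u)) : Circle) : ℂ) with hcξ
  have hleft := lineThetaLiftFun_transport_leftInvariant L N H e₁ dV hdV hdV0 μ hμ a hρ ιA hιArat μW Ψ (charCM ξ)
  -- the translate by the centre is the scalar multiple, pointwise
  have hfun : (fun x => (lineThetaKernelDatum L N e₁ dV hdV hdV0 μ hμ a hρ).thetaLiftFun μW Ψ (charCM ξ) (ιA (x * z))) =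
      fun x => cξ * (lineThetaKernelDatum L N e₁ dV hdV hdV0 μ hμ a hρ).thetaLiftFun μW Ψ (charCM ξ) (ιA x) := by
    funext x
    rw [map_mul, hz, frameTransport_adelicCenter L N H dV g ιA hιA u]
    exact lineThetaLiftFun_mul_adelicCenter L N e₁ dV hdV hdV0 μ hμ a hρ μW Ψ u ξ (ιA x)
  have hθz : MemLp (toQuotFun (adelicGroupData (↥(maximalRealSubfield L)) L (IsCMField.complexConj L) N H) fun x =>
      (lineThetaKernelDatum L N e₁ dV hdV hdV0 μ hμ a hρ).thetaLiftFun μW Ψ (charCM ξ) (ιA (x * z))) 2 ν := by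
    rw [hfun]
    exact hθ.const_mul cξ
  rw [← hz, ← toLp_toQuotFun_mul_right hleft z hθ hθz, ← MemLp.toLp_const_smul]
  exact MemLp.toLp_congr _ _ (Filter.EventuallyEq.of_eq (by rw [hfun]; rfl))

set_option maxHeartbeats 1600000 in
/-- **THE THETA CHARACTER READS THE CENTRAL CHARACTER**: if the class `[Θ̃_Ψ(ξ) ∘ ιA]` lies IN the discrete automorphic `P`, is non-zero, and the centre
acts on `P` through `χP` (★ `DiscreteAutomorphicRep.exists_centralCharacter_adelicCenter`), then `χP(u) = ξ([u·1_W])` for every `u ∈ U(1)(𝔸_{L⁺})`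
(the abstract-transport form of ★ `centralCharacter_eq_charCM`; no projection needed since the vector is in `P`).
[cite: Liu2021, proof of Prop. 4.13 Case 1 l. 2136–2137] [cite: GelbartRogawski1991, §3.1 Remark p. 457] [cite: BorelJacquet1979, §4.6] -/
theorem centralCharacter_apply_eq_charCM_of_mem
    (ν : Measure (adelicGroupData (↥(maximalRealSubfield L)) L (IsCMField.complexConj L) N H).automorphicQuotient)
    [(adelicGroupData (↥(maximalRealSubfield L)) L (IsCMField.complexConj L) N H).IsAutomorphicMeasure ν]
    (P : DiscreteAutomorphicRep (adelicGroupData (↥(maximalRealSubfield L)) L (IsCMField.complexConj L) N H) ν)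
    {χP : ↥(adelicOne (↥(maximalRealSubfield L)) L (IsCMField.complexConj L)) →* ℂˣ}
    (hχP : ∀ (u : ↥(adelicOne (↥(maximalRealSubfield L)) L (IsCMField.complexConj L))) (v : P.space.toSubmodule),
      P.space.toContRep (adelicCenter (↥(maximalRealSubfield L)) L (IsCMField.complexConj L) N H u) v = ((χP u : ℂˣ) : ℂ) • v) :
    haveI := normal_range_toAdelic_JW L a
    ∀ (ξ : PontryaginDual (↥(UnitaryGroup.adelic (↥(maximalRealSubfield L)) L (IsCMField.complexConj L) 1 (JW (↥(maximalRealSubfield L)) L a)) ⧸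
        (UnitaryGroup.toAdelic (↥(maximalRealSubfield L)) L (IsCMField.complexConj L) 1 (JW (↥(maximalRealSubfield L)) L a)).range))
      (hθ : MemLp (toQuotFun (adelicGroupData (↥(maximalRealSubfield L)) L (IsCMField.complexConj L) N H) fun x =>
        (lineThetaKernelDatum L N e₁ dV hdV hdV0 μ hμ a hρ).thetaLiftFun μW Ψ (charCM ξ) (ιA x)) 2 ν),
      MemLp.toLp _ hθ ∈ P.space.toSubmodule → MemLp.toLp _ hθ ≠ 0 →
      ∀ u : ↥(adelicOne (↥(maximalRealSubfield L)) L (IsCMField.complexConj L)),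
        ((χP u : ℂˣ) : ℂ) =
          ((ξ (QuotientGroup.mk (adelicCenter (↥(maximalRealSubfield L)) L (IsCMField.complexConj L) 1 (JW (↥(maximalRealSubfield L)) L a) u)) :
            Circle) : ℂ) := by
  haveI := normal_range_toAdelic_JW L a
  intro ξ hθ hmem hne u
  have hR := rightRegular_adelicCenter_toLp_transport_charCM L N H e₁ dV hdV hdV0 g μ hμ a hρ ιA hιA hιArat μW Ψ ν u ξ hθ
  have hψ : (adelicGroupData (↥(maximalRealSubfield L)) L (IsCMField.complexConj L) N H).rightRegular ν
      (adelicCenter (↥(maximalRealSubfield L)) L (IsCMField.complexConj L) N H u) (MemLp.toLp _ hθ) = ((χP u : ℂˣ) : ℂ) • MemLp.toLp _ hθ := by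
    have h := congrArg Subtype.val (hχP u ⟨_, hmem⟩)
    rw [ContRepresentation.ClosedSubrep.coe_toContRep_apply] at h
    exact h
  rw [hψ] at hR
  exact smul_left_injective ℂ hne hR

end Transport

/-! ## §4 On a hermitian line the centre is everything -/

section Line

variable (L : Type) [Field L] [NumberField L] [IsCMField L] (a : (↥(maximalRealSubfield L))ˣ)

omit [NumberField L] [IsCMField L] in
/-- `det (J_W a) ≠ 0`. [cite: Liu2021, App. D §D.1 Step 1] -/
theorem det_JW_ne_zero' : (JW (↥(maximalRealSubfield L)) L a).det ≠ 0 := by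
  rw [Matrix.det_fin_one]
  exact JW_apply_ne_zero (↥(maximalRealSubfield L)) L a

/-- **Every element of `U(⟨a⟩)(𝔸_{L⁺})` is central**: `h = (det h) · 1₁` (★ `coe_eq_det_smul_one`), so `u ↦ u·1_W` is ONTO `U(⟨a⟩)(𝔸_{L⁺})`.
[cite: Mok2014, §1 Notation p. 5] -/
theorem exists_adelicCenter_JW_eq
    (h : ↥(UnitaryGroup.adelic (↥(maximalRealSubfield L)) L (IsCMField.complexConj L) 1 (JW (↥(maximalRealSubfield L)) L a))) :
    ∃ u : ↥(adelicOne (↥(maximalRealSubfield L)) L (IsCMField.complexConj L)),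
      adelicCenter (↥(maximalRealSubfield L)) L (IsCMField.complexConj L) 1 (JW (↥(maximalRealSubfield L)) L a) u = h :=
  ⟨adelicDet (↥(maximalRealSubfield L)) L (IsCMField.complexConj L) 1 (JW (↥(maximalRealSubfield L)) L a) (det_JW_ne_zero' L a) h,
    Subtype.ext (Units.ext ((coe_adelicCenter (↥(maximalRealSubfield L)) L (IsCMField.complexConj L) 1 _ _).trans
      (coe_eq_det_smul_one L _).symm))⟩

/-- **Two continuous unitary characters of `[U(⟨a⟩)]` that agree on all classes `[u·1_W]`, `u ∈ U(1)(𝔸_{L⁺})`, are equal.**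
[cite: Mok2014, §1 Notation p. 5] -/
theorem charQuot_ext_of_adelicCenter :
    haveI := normal_range_toAdelic_JW L a
    ∀ (ξ ξ' : PontryaginDual (↥(UnitaryGroup.adelic (↥(maximalRealSubfield L)) L (IsCMField.complexConj L) 1 (JW (↥(maximalRealSubfield L)) L a)) ⧸
        (UnitaryGroup.toAdelic (↥(maximalRealSubfield L)) L (IsCMField.complexConj L) 1 (JW (↥(maximalRealSubfield L)) L a)).range)),
      (∀ u : ↥(adelicOne (↥(maximalRealSubfield L)) L (IsCMField.complexConj L)),
        ξ (QuotientGroup.mk (adelicCenter (↥(maximalRealSubfield L)) L (IsCMField.complexConj L) 1 (JW (↥(maximalRealSubfield L)) L a) u)) =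
          ξ' (QuotientGroup.mk (adelicCenter (↥(maximalRealSubfield L)) L (IsCMField.complexConj L) 1 (JW (↥(maximalRealSubfield L)) L a) u))) →
      ξ = ξ' := by
  haveI := normal_range_toAdelic_JW L a
  intro ξ ξ' h
  apply ContinuousMonoidHom.ext
  intro q
  obtain ⟨x, rfl⟩ := QuotientGroup.mk_surjective q
  obtain ⟨u, rfl⟩ := exists_adelicCenter_JW_eq L a x
  exact h u

end Line

/-! ## §5 The (P♭-θ) assembly: two character seams of ONE line inside representations with the same central character -/

section Assembly

variable (L : Type) [Field L] [NumberField L] [IsCMField L] (N : ℕ) (H : Matrix (Fin N) (Fin N) L)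
  {n' : ℕ} (e₁ : Fin N × Fin 1 ≃ Fin n') (dV : Fin N → L) (hdV : ∀ i, IsCMField.complexConj L (dV i) = dV i)
  (hdV0 : ∀ i, dV i ≠ 0) (g : GL (Fin N) L)
  (μ : Literature.NumberTheory.Automorphic.IdeleClassGroup L →ₜ* Circle) (hμ : IsConjugateSymplectic L μ) (a : (↥(maximalRealSubfield L))ˣ)
  (ιA : (adelicGroupData (↥(maximalRealSubfield L)) L (IsCMField.complexConj L) N H).Adelic →*
    ↥(UnitaryGroup.adelic (↥(maximalRealSubfield L)) L (IsCMField.complexConj L) N (Matrix.diagonal dV)))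
  (hιA : ∀ k, ((ιA k : ↥(UnitaryGroup.adelic (↥(maximalRealSubfield L)) L (IsCMField.complexConj L) N (Matrix.diagonal dV))) :
      GL (Fin N) (AdeleRing (𝓞 L) L)) =
    (toAdeleGL L g)⁻¹ * adelicVal (↥(maximalRealSubfield L)) L (IsCMField.complexConj L) N H k * toAdeleGL L g)
  (hιArat : ∀ γ : (adelicGroupData (↥(maximalRealSubfield L)) L (IsCMField.complexConj L) N H).Rational,
    ιA ((adelicGroupData (↥(maximalRealSubfield L)) L (IsCMField.complexConj L) N H).toAdelic γ) ∈
      (UnitaryGroup.toAdelic (↥(maximalRealSubfield L)) L (IsCMField.complexConj L) N (Matrix.diagonal dV)).range)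
  [CompactSpace (↥(UnitaryGroup.adelic (↥(maximalRealSubfield L)) L (IsCMField.complexConj L) N (Matrix.diagonal dV)) ⧸
    (UnitaryGroup.toAdelic (↥(maximalRealSubfield L)) L (IsCMField.complexConj L) N (Matrix.diagonal dV)).range)]
  [MeasurableSpace (↥(UnitaryGroup.adelic (↥(maximalRealSubfield L)) L (IsCMField.complexConj L) 1 (JW (↥(maximalRealSubfield L)) L a)) ⧸
    (UnitaryGroup.toAdelic (↥(maximalRealSubfield L)) L (IsCMField.complexConj L) 1 (JW (↥(maximalRealSubfield L)) L a)).range)]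
  [BorelSpace (↥(UnitaryGroup.adelic (↥(maximalRealSubfield L)) L (IsCMField.complexConj L) 1 (JW (↥(maximalRealSubfield L)) L a)) ⧸
    (UnitaryGroup.toAdelic (↥(maximalRealSubfield L)) L (IsCMField.complexConj L) 1 (JW (↥(maximalRealSubfield L)) L a)).range)]
  (ν : Measure (adelicGroupData (↥(maximalRealSubfield L)) L (IsCMField.complexConj L) N H).automorphicQuotient)
  [(adelicGroupData (↥(maximalRealSubfield L)) L (IsCMField.complexConj L) N H).IsAutomorphicMeasure ν]

include hιA hιArat

set_option maxHeartbeats 1600000 in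
/-- **(P♭-θ) — `charCM_eq_of_seams_of_centralCharacter_eq`.**  Let `P`, `P′` be discrete automorphic representations of `U(H)` on which the centre acts
through THE SAME character `χ` (for two `(1,0)`-type `P`, `P′` with a common finite component this is ★-candidate
`F0P6LD1CentralCharacterPin.centralCharacter_eq_of_hasFinComponent`).  If a non-zero `ξ′`-theta class from the line `⟨a⟩` along `ιA` (majorant witness `hρ′`,
finite invariant measure `μW′`, Schwartz–Bruhat `Ψ′`) lies in `P` and a non-zero `ξ″`-theta class from THE SAME line along the same `ιA` (data `hρ″, μW″, Ψ″`)
lies in `P′`, then `ξ′ = ξ″`: both equal `u ↦ χ(u)` read on `[U(⟨a⟩)]` (§3), and the centre exhausts the line (§4).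
[cite: Liu2021, App. D, proof of Prop. D.4 (1) p. 131; proof of Prop. 4.13 Case 1 l. 2136–2137] [cite: GelbartRogawski1991, §3.1 Remark p. 457] -/
theorem charCM_eq_of_seams_of_centralCharacter_eq
    (P P' : DiscreteAutomorphicRep (adelicGroupData (↥(maximalRealSubfield L)) L (IsCMField.complexConj L) N H) ν)
    {χ : ↥(adelicOne (↥(maximalRealSubfield L)) L (IsCMField.complexConj L)) →* ℂˣ}
    (hχP : ∀ (u : ↥(adelicOne (↥(maximalRealSubfield L)) L (IsCMField.complexConj L))) (v : P.space.toSubmodule),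
      P.space.toContRep (adelicCenter (↥(maximalRealSubfield L)) L (IsCMField.complexConj L) N H u) v = ((χ u : ℂˣ) : ℂ) • v)
    (hχP' : ∀ (u : ↥(adelicOne (↥(maximalRealSubfield L)) L (IsCMField.complexConj L))) (v : P'.space.toSubmodule),
      P'.space.toContRep (adelicCenter (↥(maximalRealSubfield L)) L (IsCMField.complexConj L) N H u) v = ((χ u : ℂˣ) : ℂ) • v)
    -- the seam of `P`: data `(hρ', μW', Ψ')`, character `ξ'`
    (hρ' : HasThetaMajorants fun
      (p : ↥(UnitaryGroup.adelic (↥(maximalRealSubfield L)) L (IsCMField.complexConj L) N (Matrix.diagonal dV)) ×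
        ↥(UnitaryGroup.adelic (↥(maximalRealSubfield L)) L (IsCMField.complexConj L) 1 (JW (↥(maximalRealSubfield L)) L a)))
      (Φ : piSchwartzBruhat (↥(maximalRealSubfield L)) (Fin n')) =>
        (pairRep (↥(maximalRealSubfield L)) L (IsCMField.complexConj L) N 1 e₁ (Matrix.diagonal dV) (JW (↥(maximalRealSubfield L)) L a)
          (chiSplittingLine L e₁ dV hdV hdV0 (toHeckeCharacter L μ) (isUnitary_toHeckeCharacter L μ)
            ((isOscillatorChar_toHeckeCharacter_iff μ).mpr hμ) (TW (↥(maximalRealSubfield L)) a)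
            (isUnit_det_TW (↥(maximalRealSubfield L)) a) (JW (↥(maximalRealSubfield L)) L a) (JW_eq (↥(maximalRealSubfield L)) L a))) p Φ)
    (μW' : Measure (↥(UnitaryGroup.adelic (↥(maximalRealSubfield L)) L (IsCMField.complexConj L) 1 (JW (↥(maximalRealSubfield L)) L a)) ⧸
      (UnitaryGroup.toAdelic (↥(maximalRealSubfield L)) L (IsCMField.complexConj L) 1 (JW (↥(maximalRealSubfield L)) L a)).range))
    [IsFiniteMeasure μW']
    [SMulInvariantMeasure
      ↥(UnitaryGroup.adelic (↥(maximalRealSubfield L)) L (IsCMField.complexConj L) 1 (JW (↥(maximalRealSubfield L)) L a))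
      (↥(UnitaryGroup.adelic (↥(maximalRealSubfield L)) L (IsCMField.complexConj L) 1 (JW (↥(maximalRealSubfield L)) L a)) ⧸
        (UnitaryGroup.toAdelic (↥(maximalRealSubfield L)) L (IsCMField.complexConj L) 1 (JW (↥(maximalRealSubfield L)) L a)).range) μW']
    (Ψ' : piSchwartzBruhat (↥(maximalRealSubfield L)) (Fin n'))
    -- the seam of `P'`: data `(hρ'', μW'', Ψ'')`, character `ξ''`
    (hρ'' : HasThetaMajorants fun
      (p : ↥(UnitaryGroup.adelic (↥(maximalRealSubfield L)) L (IsCMField.complexConj L) N (Matrix.diagonal dV)) ×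
        ↥(UnitaryGroup.adelic (↥(maximalRealSubfield L)) L (IsCMField.complexConj L) 1 (JW (↥(maximalRealSubfield L)) L a)))
      (Φ : piSchwartzBruhat (↥(maximalRealSubfield L)) (Fin n')) =>
        (pairRep (↥(maximalRealSubfield L)) L (IsCMField.complexConj L) N 1 e₁ (Matrix.diagonal dV) (JW (↥(maximalRealSubfield L)) L a)
          (chiSplittingLine L e₁ dV hdV hdV0 (toHeckeCharacter L μ) (isUnitary_toHeckeCharacter L μ)
            ((isOscillatorChar_toHeckeCharacter_iff μ).mpr hμ) (TW (↥(maximalRealSubfield L)) a)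
            (isUnit_det_TW (↥(maximalRealSubfield L)) a) (JW (↥(maximalRealSubfield L)) L a) (JW_eq (↥(maximalRealSubfield L)) L a))) p Φ)
    (μW'' : Measure (↥(UnitaryGroup.adelic (↥(maximalRealSubfield L)) L (IsCMField.complexConj L) 1 (JW (↥(maximalRealSubfield L)) L a)) ⧸
      (UnitaryGroup.toAdelic (↥(maximalRealSubfield L)) L (IsCMField.complexConj L) 1 (JW (↥(maximalRealSubfield L)) L a)).range))
    [IsFiniteMeasure μW'']
    [SMulInvariantMeasure
      ↥(UnitaryGroup.adelic (↥(maximalRealSubfield L)) L (IsCMField.complexConj L) 1 (JW (↥(maximalRealSubfield L)) L a))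
      (↥(UnitaryGroup.adelic (↥(maximalRealSubfield L)) L (IsCMField.complexConj L) 1 (JW (↥(maximalRealSubfield L)) L a)) ⧸
        (UnitaryGroup.toAdelic (↥(maximalRealSubfield L)) L (IsCMField.complexConj L) 1 (JW (↥(maximalRealSubfield L)) L a)).range) μW'']
    (Ψ'' : piSchwartzBruhat (↥(maximalRealSubfield L)) (Fin n')) :
    haveI := normal_range_toAdelic_JW L a
    ∀ (ξ' ξ'' : PontryaginDual (↥(UnitaryGroup.adelic (↥(maximalRealSubfield L)) L (IsCMField.complexConj L) 1 (JW (↥(maximalRealSubfield L)) L a)) ⧸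
        (UnitaryGroup.toAdelic (↥(maximalRealSubfield L)) L (IsCMField.complexConj L) 1 (JW (↥(maximalRealSubfield L)) L a)).range))
      (hθ' : MemLp (toQuotFun (adelicGroupData (↥(maximalRealSubfield L)) L (IsCMField.complexConj L) N H) fun x =>
        (lineThetaKernelDatum L N e₁ dV hdV hdV0 μ hμ a hρ').thetaLiftFun μW' Ψ' (charCM ξ') (ιA x)) 2 ν)
      (hθ'' : MemLp (toQuotFun (adelicGroupData (↥(maximalRealSubfield L)) L (IsCMField.complexConj L) N H) fun x =>
        (lineThetaKernelDatum L N e₁ dV hdV hdV0 μ hμ a hρ'').thetaLiftFun μW'' Ψ'' (charCM ξ'') (ιA x)) 2 ν),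
      MemLp.toLp _ hθ' ∈ P.space.toSubmodule → MemLp.toLp _ hθ' ≠ 0 →
      MemLp.toLp _ hθ'' ∈ P'.space.toSubmodule → MemLp.toLp _ hθ'' ≠ 0 → ξ' = ξ'' := by
  haveI := normal_range_toAdelic_JW L a
  intro ξ' ξ'' hθ' hθ'' hmem' hne' hmem'' hne''
  refine charQuot_ext_of_adelicCenter L a ξ' ξ'' fun u => Circle.ext ?_
  have h1 := centralCharacter_apply_eq_charCM_of_mem L N H e₁ dV hdV hdV0 g μ hμ a hρ' ιA hιA hιArat μW' Ψ' ν P hχP ξ' hθ' hmem' hne' u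
  have h2 := centralCharacter_apply_eq_charCM_of_mem L N H e₁ dV hdV hdV0 g μ hμ a hρ'' ιA hιA hιArat μW'' Ψ'' ν P' hχP' ξ'' hθ'' hmem'' hne'' u
  exact h1.symm.trans h2

end Assembly

end Summit.HodgeConjecture.HodgeConjecture.Cruxes.HLiu418.F0P6LD1ThetaCharacterPin

end
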